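import Summits.BirchSwinnertonDyer.BirchSwinnertonDyer.Theorems.PrintCf2RamifiedShuZhaiTwoFiftySixOfFactsPlus
import HarnessLib

/-!
# Route PrintCf2 — aside item `RamifiedShuZhaiTwoFiftySixClassOfFactsPlus` (id: see ledger; planner g4 «next batch») CLOSED

Cell `bsd-print-cf2`, prover p2. The ISOGENY-CLASS twin of aside 21183: 𝔅_ram⁺ (= 21183's antecedent VERBATIM) ⟹ the W-ALL
leaf `Summit.BirchSwinnertonDyer.WAllCornerFTwoRamifiedShuZhaiTwoFiftySix` (BSD(W,2) for every globally minimal CM curve of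
analytic rank one with `2` ramified in `K` that is `ℚ`-ISOGENOUS to a Shu–Zhai twist `256c1^{(−pM)}`; adds the models of
`y² = x³ − 8p²M²x`; Cassels = conjunct 3 of 𝔅_ram). Proof: `ramifiedShuZhaiTwoFiftySixLeaf_of_bundlePlus` (p555534).
beyond-print: NO. [cite: ShuZhai2021, Thm. 1.2 and Thm. 1.4] [cite: MilneADT2006, Thm. I.7.3]
[cite: Cremona1997, Table 1 (N = 256, curve C1) and Table 4 (row 256C)] [cite: AgasheRibetStein2006, Thm. 2.6]
-/

-- single-conjunct summit: `Summit.BirchSwinnertonDyer.BirchSwinnertonDyer.…` repeats the name by design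
set_option linter.dupNamespace false

namespace Summit.BirchSwinnertonDyer.BirchSwinnertonDyer.Theorems

/-- **Item `RamifiedShuZhaiTwoFiftySixClassOfFactsPlus` holds**: 𝔅_ram⁺ ⟹ `WAllCornerFTwoRamifiedShuZhaiTwoFiftySix`, by
`ramifiedShuZhaiTwoFiftySixLeaf_of_bundlePlus`. [cite: ShuZhai2021, Thm. 1.2 and Thm. 1.4] [cite: MilneADT2006, Thm. I.7.3] -/
theorem ramifiedShuZhaiTwoFiftySixClassOfFactsPlus_proof :
    Summit.BirchSwinnertonDyer.BirchSwinnertonDyer.Theses.PrintCf2.RamifiedShuZhaiTwoFiftySixClassOfFactsPlus := by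
  unfold Summit.BirchSwinnertonDyer.BirchSwinnertonDyer.Theses.PrintCf2.RamifiedShuZhaiTwoFiftySixClassOfFactsPlus
  exact ramifiedShuZhaiTwoFiftySixLeaf_of_bundlePlus

end Summit.BirchSwinnertonDyer.BirchSwinnertonDyer.Theorems
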